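import Summits.BirchSwinnertonDyer.BirchSwinnertonDyer.Theorems.KolyvaginDepthDoorDepthTableRowKitNoTwistOfDatum
import Summits.BirchSwinnertonDyer.BirchSwinnertonDyer.Theorems.KolyvaginDepthDoorKolyvaginDepthSupplyDoorOfDatumPrint
import Literature.NumberTheory.DiophantineGeometry.TameAdditiveTypesAtTwoProofs
import Literature.NumberTheory.DiophantineGeometry.MinimalDiscriminantRingOfIntegersProofs
import Literature.NumberTheory.DiophantineGeometry.MinimalDiscriminantProofs
import HarnessLib

/-!
# Route `KolyvaginDepthDoor` — the DEPTH-TABLE ROW KIT ON PRINT-STANDARD INPUTS: the five McCallum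
# leaves replaced by (γ) [Gross 1991 Prop. 3.7 (2)] + a Kodaira–Néron certificate read off the
# integer model (crux `KolyvaginDepthSupply`, stmt-BirchSwinnertonDyer-21765)

Helper file (`--supports stmt-BirchSwinnertonDyer-21765 --as helper`); it closes nothing and BSD is
not proved by it.

g7's kit `depthRow_noTwist_of_datum_of_intModel_certificate` (file `…DepthTableRowKitNoTwistOfDatum`)
reads a rank-2 depth-table row off an integer-model certificate, ONE datum and its bit, modulo the five
named McCallum / Gross leaves. This file runs the same kit over the door ON PRINT-STANDARD INPUTS
(`…DoorOfDatumPrint`): the leaves are gone; what replaces them is the ONE Literature fact (γ)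
`GrossLMS1991.prop37_2_frobeniusCongruence` and the Kodaira–Néron side condition (KN_p) "`p ∤ ord_v(Δ_min)`
at the multiplicative places" — which this file CERTIFIES from the integer model:

* `ordMinimalDiscriminant_eq_padicValInt_natGenerator_ringOfIntegers` — for a globally minimal `W/ℚ`,
  `ord_v(Δ_min) = v_q(Δ(integral model))` at the place `v` of `𝓞 ℚ` above `q` (transport
  `𝓞 ℚ ↔ ℤ` through the tree's `ordMinimalDiscriminant_eq_padic`, then
  `ordMinimalDiscriminant_eq_padicValInt_natGenerator'`).
* `not_dvd_ordMinimalDiscriminant_of_intModel_table` — **(KN_p) from a finite, `decide`-able table**: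
  if `|Δ(E₀)| < B^p` and, for every prime `q < B` dividing `Δ(E₀)`, the exact exponent `e = v_q(Δ(E₀))`
  is exhibited with `p ∤ e`, then `p ∤ ord_v(Δ_min)` at every multiplicative place `v` (primes
  `q ≥ B` have `1 ≤ v_q(Δ) < p` automatically).
* `depthRow_print_of_datum_of_intModel_certificate` — **THE ROW KIT**: inputs = g7's integer-model
  certificate of the row + (γ) + the (KN_p) table + ONE datum `d` of conductor `ℓ` with its bit
  `d.kolyvaginClass _ 1 ≠ 0`; OUTPUT: `corank_{ℤ_p} Ш(E/ℚ)[p^∞] = 0`, `rank_ℤ E(ℚ) = 2`,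
  `rank_ℤ E^{(D)}(ℚ) ≤ 1`, `E(ℚ)[p] = 0`, `Ш(E/ℚ)[p] = 0`, `#Sel^(p)(E/ℚ) = p²`.
* `depthRow_print_of_datum_of_intModel_certificate_gross1991E0` — the same with (KN_p) replaced by the
  Literature fact F1 = [GZ86 III (3.1)] (for the rows off the Kodaira–Néron cell).

CONDITIONAL on (γ) [+ F1] and the bit; per-curve; BSD is not proved by it.

References: [Kolyvagin1991MathAnn] Thm. 2.3; [GrossLMS1991] Prop. 3.7 (2), §§3–6, §10;
[McCallumLMS1991] §§2–5; [SilvermanAEC2009] VII.6.1, VIII.8; [WZhang2014] Notations (xii);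
[JetchevLauterStein2009] §3.6.
-/

set_option linter.dupNamespace false

noncomputable section

open scoped Classical NumberField

namespace Summit.BirchSwinnertonDyer.BirchSwinnertonDyer.Theorems.KolyvaginDepthDoor

open Literature.NumberTheory.EllipticCurves Literature.NumberTheory.EllipticCurves.ModularForms
  Literature.NumberTheory.EllipticCurves.McCallum1991 WeierstrassCurve NumberField IsDedekindDomain
open Literature.NumberTheory.DiophantineGeometry (KodairaSymbol)

/-! ## (KN_p) read off the integer model -/

section KodairaNeron

variable {W : WeierstrassCurve ℚ} [W.IsElliptic] [W.IsGloballyMinimal]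

/-- **`ord_v(Δ_min) = v_q(Δ_{min})` at the place `v` of `𝓞 ℚ` above the prime `q`**, for a
globally minimal `W/ℚ` (`Δ_min = W.minimalDiscriminantInt`, the discriminant of the integral model):
the tree's `ordMinimalDiscriminant_eq_padicValInt_natGenerator'` (places of `ℤ`) transported to the
places of `𝓞 ℚ` through the `R`-independent `p`-adic description `ordMinimalDiscriminant_eq_padic`.
[cite: SilvermanAEC2009, VIII.8] -/
theorem ordMinimalDiscriminant_eq_padicValInt_natGenerator_ringOfIntegers
    (v : HeightOneSpectrum (𝓞 ℚ)) :
    W.ordMinimalDiscriminant v =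
      padicValInt (Rat.HeightOneSpectrum.natGenerator v) W.minimalDiscriminantInt := by
  set v' : HeightOneSpectrum ℤ :=
    (Rat.HeightOneSpectrum.primesEquiv (R := ℤ)).symm (Rat.HeightOneSpectrum.primesEquiv v) with hv'
  have hvv' : Rat.HeightOneSpectrum.primesEquiv v' = Rat.HeightOneSpectrum.primesEquiv v := by
    rw [hv', Equiv.apply_symm_apply]
  have htrans : W.ordMinimalDiscriminant v = W.ordMinimalDiscriminant v' := by
    rw [W.ordMinimalDiscriminant_eq_padic v, W.ordMinimalDiscriminant_eq_padic v', hvv']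
  have hgen : Rat.HeightOneSpectrum.natGenerator v' = Rat.HeightOneSpectrum.natGenerator v := by
    change (Rat.HeightOneSpectrum.primesEquiv v' : ℕ) = (Rat.HeightOneSpectrum.primesEquiv v : ℕ)
    rw [hvv']
  rw [htrans, W.ordMinimalDiscriminant_eq_padicValInt_natGenerator' v', hgen]

/-- **(KN_p) from a finite table**: for `W/ℚ` globally minimal elliptic with integer model `E₀` of
discriminant `Δ₀`, a natural number `p`, a bound `B` with `|Δ₀| < B ^ p`, and for every prime `q < B`
dividing `Δ₀` an exhibited exact exponent `e` (`q^e ∣ Δ₀`, `q^{e+1} ∤ Δ₀`) with `p ∤ e`: at every place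
`v` of MULTIPLICATIVE reduction, `p ∤ ord_v(Δ_min)`. (At a multiplicative `v` above `q` one has
`1 ≤ ord_v(Δ_min) = v_q(Δ₀)`; for `q ≥ B`, `q^{v_q(Δ₀)} ≤ |Δ₀| < B^p ≤ q^p` forces `v_q(Δ₀) < p`.)
The table is `decide`-able. [cite: SilvermanAEC2009, VII.5.1, VIII.8] -/
theorem not_dvd_ordMinimalDiscriminant_of_intModel_table {E₀ : WeierstrassCurve ℤ}
    (hI : integralModelInt W = E₀) {p : ℕ} {Δ₀ : ℤ} (hΔ : E₀.Δ = Δ₀) {B : ℕ}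
    (hB : Δ₀.natAbs < B ^ p)
    (htab : ∀ q ∈ Finset.range B, q.Prime → q ∣ Δ₀.natAbs →
      ∃ e ∈ Finset.range 64, q ^ e ∣ Δ₀.natAbs ∧ ¬ q ^ (e + 1) ∣ Δ₀.natAbs ∧ ¬ p ∣ e)
    (v : HeightOneSpectrum (𝓞 ℚ)) (hv : W.HasMultiplicativeReductionAt v) :
    ¬ p ∣ W.ordMinimalDiscriminant v := by
  set q := Rat.HeightOneSpectrum.natGenerator v with hq
  have hqP : q.Prime := Rat.HeightOneSpectrum.prime_natGenerator v
  haveI : Fact q.Prime := ⟨hqP⟩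
  -- `ord_v(Δ_min) = v_q(Δ₀)`
  have hord : W.ordMinimalDiscriminant v = padicValNat q Δ₀.natAbs := by
    rw [ordMinimalDiscriminant_eq_padicValInt_natGenerator_ringOfIntegers v, padicValInt,
      WeierstrassCurve.minimalDiscriminantInt, hI, hΔ]
  -- multiplicative ⟹ `ord_v(Δ_min) ≠ 0`
  have hne : W.ordMinimalDiscriminant v ≠ 0 := fun h0 ↦
    hv.not_hasGoodReductionAt ((W.ordMinimalDiscriminant_eq_zero_iff_holds v).mp h0)
  rw [hord] at hne ⊢
  set n := Δ₀.natAbs with hn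
  have hn0 : n ≠ 0 := by
    intro h0
    rw [h0, padicValNat_zero_right] at hne
    exact hne rfl
  have hk1 : 1 ≤ padicValNat q n := Nat.one_le_iff_ne_zero.mpr hne
  have hqn : q ∣ n := dvd_of_one_le_padicValNat hk1
  have hqk : q ^ padicValNat q n ∣ n := pow_padicValNat_dvd
  by_cases hqB : q < B
  · -- the table fixes `v_q(n) = e` with `p ∤ e`
    obtain ⟨e, -, he, he1, hpe⟩ := htab q (Finset.mem_range.mpr hqB) hqP hqn
    have hle : e ≤ padicValNat q n := (padicValNat_dvd_iff_le hn0).mp he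
    have hlt : ¬ e + 1 ≤ padicValNat q n := fun h ↦ he1 ((padicValNat_dvd_iff_le hn0).mpr h)
    have heq : padicValNat q n = e := by omega
    rwa [heq]
  · -- `q ≥ B`: `q ^ v_q(n) ≤ n < B ^ p ≤ q ^ p`, so `1 ≤ v_q(n) < p`
    push Not at hqB
    have hle : q ^ padicValNat q n ≤ n := Nat.le_of_dvd (Nat.pos_of_ne_zero hn0) hqk
    have hBq : B ^ p ≤ q ^ p := Nat.pow_le_pow_left hqB p
    have hlt : q ^ padicValNat q n < q ^ p := lt_of_le_of_lt hle (lt_of_lt_of_le hB hBq)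
    have hkp : padicValNat q n < p := (Nat.pow_lt_pow_iff_right hqP.one_lt).mp hlt
    intro hdvd
    exact absurd (Nat.le_of_dvd hk1 hdvd) (not_le.mpr hkp)

end KodairaNeron

/-! ## The row kit -/

section Generic

variable {W : WeierstrassCurve ℚ} [W.IsElliptic] [W.IsGloballyMinimal] {E₀ : WeierstrassCurve ℤ}
  (hI : integralModelInt W = E₀)
include hI

/-- **The depth-table row off an integer model ON PRINT-STANDARD INPUTS (no McCallum leaf, no `hF`,
no twist point, no system).** Inputs: globally minimal non-CM `W/ℚ` with integer model `E₀`,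
`2 ≤ rank_ℤ E(ℚ)`, `p` odd with `ρ̄_{E,p^n}` onto for all `n`, an imaginary quadratic `K` with
`d_K = D ∉ {−3, −4}` in which every prime of `Δ(E₀)` splits, an odd prime `ℓ ∤ Δ(E₀) D`, `ℓ ≠ p`,
`(D/ℓ) = −1`, `p ∣ ℓ + 1`, `p ∣ ℓ + 1 − #(E₀ mod ℓ)(𝔽_ℓ)`; the ONE named fact
(γ) = `GrossLMS1991.prop37_2_frobeniusCongruence`; the Kodaira–Néron table of `Δ(E₀) = Δ₀` at `p`
(`|Δ₀| < B^p` and the exact exponents of the primes `q < B` of `Δ₀`, none divisible by `p`) and —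
void for `p ≠ 3` — no additive place of type IV / IV*; a frame `(Dt, β, ι)` and ONE datum
`d : KolyvaginHeegnerData Dt β ι ℓ`. OUTPUT from the bit `d.kolyvaginClass hp 1 ≠ 0`:
`corank_{ℤ_p} Ш(E/ℚ)[p^∞] = 0`, `rank_ℤ E(ℚ) = 2`, `rank_ℤ E^{(D)}(ℚ) ≤ 1`, `E(ℚ)[p] = 0`,
`Ш(E/ℚ)[p] = 0`, `#Sel^(p)(E/ℚ) = p²`. CONDITIONAL on (γ); per-curve; BSD is not proved by it.
[cite: Kolyvagin1991MathAnn, Thm. 2.3] [cite: GrossLMS1991, Prop. 3.7 (2), §5 (5.1), Prop. 6.2 (1)]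
[cite: McCallumLMS1991, §§2–5] [cite: SilvermanAEC2009, VII.6.1] [cite: WZhang2014, Notations (xii)]
[cite: JetchevLauterStein2009, §3.6 (arXiv:0707.0032)] -/
theorem depthRow_print_of_datum_of_intModel_certificate
    (h372 : GrossLMS1991.prop37_2_frobeniusCongruence)
    (hcm : ¬ W.HasCM) (hr : 2 ≤ W.mordellWeilRank)
    (p : ℕ) [hp : Fact p.Prime] (hp2 : p ≠ 2)
    (htower : ∀ n : ℕ, W.HasSurjectiveModNGaloisRep (p ^ n : ℕ))
    (K : Type) [Field K] [NumberField K] (hK : IsImaginaryQuadratic K) {D : ℤ}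
    (hD : NumberField.discr K = D) (h3 : D ≠ -3) (h4 : D ≠ -4)
    (hH : ∀ q : ℕ, q.Prime → (q : ℤ) ∣ E₀.Δ → (q = 2 → D % 8 = 1) ∧ (q ≠ 2 → jacobiSym D q = 1))
    (ℓ : ℕ) (hℓ : ℓ.Prime) (hℓ2 : ℓ ≠ 2) (hℓΔ : ¬ (ℓ : ℤ) ∣ E₀.Δ) (hℓD : ¬ (ℓ : ℤ) ∣ D)
    (hℓp : ℓ ≠ p) (hjac : jacobiSym D ℓ = -1) (hℓ1 : p ∣ ℓ + 1) {n : ℕ}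
    (hcard : Nat.card ((E₀.map (Int.castRingHom (ZMod ℓ))).toAffine.Point) = n)
    (haℓ : (p : ℤ) ∣ (ℓ : ℤ) + 1 - n)
    {Δ₀ : ℤ} (hΔ : E₀.Δ = Δ₀) {B : ℕ} (hB : Δ₀.natAbs < B ^ p)
    (htab : ∀ q ∈ Finset.range B, q.Prime → q ∣ Δ₀.natAbs →
      ∃ e ∈ Finset.range 64, q ^ e ∣ Δ₀.natAbs ∧ ¬ q ^ (e + 1) ∣ Δ₀.natAbs ∧ ¬ p ∣ e)
    (hadd : ∀ v : HeightOneSpectrum (𝓞 ℚ), W.HasAdditiveReductionAt v → p ≠ 3 ∨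
      (W.kodairaSymbolAt v ≠ KodairaSymbol.IV ∧ W.kodairaSymbolAt v ≠ KodairaSymbol.IVstar))
    [NeZero (W.conductorNorm ℤ)] (Dt : ModularParametrizationData W (W.conductorNorm ℤ)) (β : ℤ)
    (ι : K →+* ℂ) (d : KolyvaginHeegnerData Dt β ι ℓ) (hne : d.kolyvaginClass hp.out 1 ≠ 0) :
    W.shaCorank p = 0 ∧ W.mordellWeilRank = 2 ∧ (W.quadraticTwist (D : ℚ)).mordellWeilRank ≤ 1 ∧
      (∀ P : W.toAffine.Point, p • P = 0 → P = 0) ∧ (∀ c ∈ W.sha, p • c = 0 → c = 0) ∧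
      Nat.card ↥(selmerGroup W (p : ℤ)) = p ^ 2 := by
  obtain ⟨hkol, -⟩ := isKolyvaginPrime_of_intModel_certificate hI p K hK.1 hD ℓ hℓ hℓ2 hℓΔ hℓD
    hℓp hjac hℓ1 hcard haℓ
  obtain ⟨c, hc, hcc⟩ := exists_conj_of_isImaginaryQuadratic K hK
  have hH' := satisfiesHeegnerHypothesis_conductorNorm_of_intModel hI K hK.1 hD hH
  have hmult : ∀ v : HeightOneSpectrum (𝓞 ℚ), W.HasMultiplicativeReductionAt v →
      ¬ p ∣ W.ordMinimalDiscriminant v :=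
    not_dvd_ordMinimalDiscriminant_of_intModel_table hI hΔ hB htab
  obtain ⟨hsha, hr, hr', ht, hbot, hSel⟩ :=
    shaCorank_eq_zero_of_two_le_rank_of_kolyvaginClass_prime_ne_zero_of_datum_kodairaNeron h372 hcm hK
      (by rw [hD]; exact h3) (by rw [hD]; exact h4) hH' p hp2 htower c hc hcc hmult hadd hkol d hne hr
  rw [hD] at hr'
  refine ⟨hsha, hr, hr', fun P hP ↦ ?_, fun x hx hpx ↦ ?_, hSel⟩
  · have hmem : P ∈ AddSubgroup.torsionBy W.toAffine.Point (p : ℤ) :=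
      AddSubgroup.torsionBy.nsmul_iff.mpr hP
    rw [AddSubgroup.card_eq_one.mp ht] at hmem
    exact (AddSubgroup.mem_bot).mp hmem
  · have hmem : x ∈ W.sha ⊓ AddSubgroup.torsionBy W.galH1 (p : ℤ) :=
      AddSubgroup.mem_inf.mpr ⟨hx, AddSubgroup.torsionBy.nsmul_iff.mpr hpx⟩
    rw [hbot] at hmem
    exact (AddSubgroup.mem_bot).mp hmem

/-- **The same row kit OFF the Kodaira–Néron cell**: (KN_p) replaced by the Literature fact
F1 = `Gross1991_heegnerPoint_sub_ratTorsion_mem_E0` ([GZ86 III (3.1)]; XL, cite-only). CONDITIONAL on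
(γ) + F1; per-curve; BSD is not proved by it. [cite: Kolyvagin1991MathAnn, Thm. 2.3]
[cite: GrossLMS1991, Prop. 3.7 (2), Prop. 6.2 (1)] [cite: GrossZagier1986, III (3.1)]
[cite: McCallumLMS1991, §§2–5] [cite: JetchevLauterStein2009, §3.6 (arXiv:0707.0032)] -/
theorem depthRow_print_of_datum_of_intModel_certificate_gross1991E0
    (h372 : GrossLMS1991.prop37_2_frobeniusCongruence)
    (hE0 : Gross1991_heegnerPoint_sub_ratTorsion_mem_E0)
    (hcm : ¬ W.HasCM) (hr : 2 ≤ W.mordellWeilRank)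
    (p : ℕ) [hp : Fact p.Prime] (hp2 : p ≠ 2)
    (htower : ∀ n : ℕ, W.HasSurjectiveModNGaloisRep (p ^ n : ℕ))
    (K : Type) [Field K] [NumberField K] (hK : IsImaginaryQuadratic K) {D : ℤ}
    (hD : NumberField.discr K = D) (h3 : D ≠ -3) (h4 : D ≠ -4)
    (hH : ∀ q : ℕ, q.Prime → (q : ℤ) ∣ E₀.Δ → (q = 2 → D % 8 = 1) ∧ (q ≠ 2 → jacobiSym D q = 1))
    (ℓ : ℕ) (hℓ : ℓ.Prime) (hℓ2 : ℓ ≠ 2) (hℓΔ : ¬ (ℓ : ℤ) ∣ E₀.Δ) (hℓD : ¬ (ℓ : ℤ) ∣ D)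
    (hℓp : ℓ ≠ p) (hjac : jacobiSym D ℓ = -1) (hℓ1 : p ∣ ℓ + 1) {n : ℕ}
    (hcard : Nat.card ((E₀.map (Int.castRingHom (ZMod ℓ))).toAffine.Point) = n)
    (haℓ : (p : ℤ) ∣ (ℓ : ℤ) + 1 - n)
    [NeZero (W.conductorNorm ℤ)] (Dt : ModularParametrizationData W (W.conductorNorm ℤ)) (β : ℤ)
    (ι : K →+* ℂ) (d : KolyvaginHeegnerData Dt β ι ℓ) (hne : d.kolyvaginClass hp.out 1 ≠ 0) :
    W.shaCorank p = 0 ∧ W.mordellWeilRank = 2 ∧ (W.quadraticTwist (D : ℚ)).mordellWeilRank ≤ 1 ∧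
      (∀ P : W.toAffine.Point, p • P = 0 → P = 0) ∧ (∀ c ∈ W.sha, p • c = 0 → c = 0) ∧
      Nat.card ↥(selmerGroup W (p : ℤ)) = p ^ 2 := by
  obtain ⟨hkol, -⟩ := isKolyvaginPrime_of_intModel_certificate hI p K hK.1 hD ℓ hℓ hℓ2 hℓΔ hℓD
    hℓp hjac hℓ1 hcard haℓ
  obtain ⟨c, hc, hcc⟩ := exists_conj_of_isImaginaryQuadratic K hK
  have hH' := satisfiesHeegnerHypothesis_conductorNorm_of_intModel hI K hK.1 hD hH
  obtain ⟨hsha, hr, hr', ht, hbot, hSel⟩ :=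
    shaCorank_eq_zero_of_two_le_rank_of_kolyvaginClass_prime_ne_zero_of_datum_gross1991E0 h372 hE0 hcm
      hK (by rw [hD]; exact h3) (by rw [hD]; exact h4) hH' p hp2 htower c hc hcc hkol d hne hr
  rw [hD] at hr'
  refine ⟨hsha, hr, hr', fun P hP ↦ ?_, fun x hx hpx ↦ ?_, hSel⟩
  · have hmem : P ∈ AddSubgroup.torsionBy W.toAffine.Point (p : ℤ) :=
      AddSubgroup.torsionBy.nsmul_iff.mpr hP
    rw [AddSubgroup.card_eq_one.mp ht] at hmem
    exact (AddSubgroup.mem_bot).mp hmem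
  · have hmem : x ∈ W.sha ⊓ AddSubgroup.torsionBy W.galH1 (p : ℤ) :=
      AddSubgroup.mem_inf.mpr ⟨hx, AddSubgroup.torsionBy.nsmul_iff.mpr hpx⟩
    rw [hbot] at hmem
    exact (AddSubgroup.mem_bot).mp hmem

end Generic

end Summit.BirchSwinnertonDyer.BirchSwinnertonDyer.Theorems.KolyvaginDepthDoor

end
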